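import Literature.AnabelianGeometry.AbsoluteAnabelian.AbsTopIProp410CompactCaseProofs
import Literature.AnabelianGeometry.SemiGraphs.TemperedCurveGroupLevelDataNonVacuity2
import Literature.AnabelianGeometry.SemiGraphs.ProSigmaCompletionTFG
import Literature.AnabelianGeometry.SemiGraphs.ProSigmaCompletionModels
import Literature.GroupTheory.FreeGroupProfiniteCompletionSlim
import HarnessLib

/-!
# [AbsTopI] Prop 4.10 (iii) at the construction is INHABITED: the compact model
# `G_{ℚ_p} × F̂₃ ↠ G_{ℚ_p} × F̂₂` (a NON-VACUITY witness for node AbsTopI:Prop4.10(iii); proof-only)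

S. Mochizuki, *Topics in Absolute Anabelian Geometry I: Generalities* [AbsTopI] (J. Math. Sci.
Univ. Tokyo 19 (2012)), Def 4.2 (i)(c) p. 49 / (iii)(c) p. 50 ("de-cuspidalization" … "a surjection
`Π_j ↠ Π_{j+1}` … whose kernel is topologically normally generated by the inertia group of a cusp"),
§0 p. 8 (co-free completion), Prop 4.10 (iii) p. 60; manuscript pagination, lit key
`paper:url-11ac98ba15fc`, read on the page.

Context: node AbsTopI:Prop4.10(iii) of `HOME/plan/L4/SUBDAG-AbsTopI-Prop410.md` is PROVED AT THE
CONSTRUCTION modulo five residues in general (`prop410iiiAt_of_geometric_residues`) and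
UNCONDITIONALLY IN THE COMPACT CASE (`DeCuspidalization.prop410iiiAt_of_compactSpace`, companion
`AbsTopIProp410CompactCaseProofs.lean`: hypotheses `CompactSpace Π^tp_X`, tfg `Δ^tp_X`, `dX`, `dY`).
The one inhabitant of `DeCuspidalization X Y` in the tree so far (abc-iut-w5-d197's
`G_{ℚ_p} × F̂₂ ↠ G_{ℚ_p} × Ẑ`, `AbsTopIProp410DeCuspidalizationNonVacuity.lean`) has an ABELIAN
`Δ^tp_Y = Ẑ` — not slim, so no `dY`, and the closers do not apply to it.  THIS FILE records a datum at
which they DO apply, every hypothesis PROVED: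
* `X`: `K = ℚ_p`, `Π^tp_X := G_{ℚ_p} × F̂₃` (compact, `toHat = id`), one closed point, a CUSP, with
  `D_x = G_{ℚ_p} × îa(Ẑ)`, `I_x = 1 × îa(Ẑ) ≃ₜ* Ẑ` (`îa` completes `k ↦ a^k`, `F₃ = ⟨a, b, c⟩`);
* `Y`: `Π^tp_Y := G_{ℚ_p} × F̂₂`, no closed points — `Δ^tp_Y = F̂₂` SLIM ([AbsAnab] Lem 1.3.1, the
  tree's `Literature.GroupTheory.isSlimGroup_profiniteCompletion_freeGroup`);
* `f = f̂ := id × π̂`, `π̂ : F̂₃ → F̂₂` completing `π : a ↦ 1, b ↦ x, c ↦ y`, with continuous section `ŝ`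
  completing `x ↦ b, y ↦ c`.
Kernel clause `Ker f̂ = cl·ncl(I_x)` (pattern of w5-d197's witness): "⊇" as `π̂ ∘ îa = 1`; "⊆" because
`y ↦ [(y₁, ŝ(π̂ y₂))]` into the Hausdorff `Π/N`, `N := cl·ncl(I_x)`, is continuous and agrees with the
projection on the dense `G_{ℚ_p} × η(F₃)` — `s(π u)⁻¹ · u ∈ ⟨⟨a⟩⟩` since `F₃ → F₃/⟨⟨a⟩⟩` factors
through `s ∘ π` (`FreeGroup.ext_hom`) — hence everywhere (`DenseRange.equalizer`).  Then `dX`, `dY` by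
`nonempty_groupLevelData_of_compactSpace` (general: a compact, totally disconnected, second countable
§6 datum with slim `Π^tp`, `Δ^tp` carries `GroupLevelData` — `G_{ℚ_p}` slim by [pGC] Lem 15.8
`IsSubpadicFor.isSlimGroup_absoluteGaloisGroup`, products, `TemperedCurve.galoisIdentification`), tfg
of `Δ^tp_X ≅ F̂₃`, and the compact-case closers: **`∃ X Y E, Prop410iiiAt E ∧ Prop410iiiDeltaAt E`**.

HONEST LABEL: a direct-product COMPACT model, not the tempered fundamental group of a hyperbolic
curve (none is in the tree; a genuine `Π^tp` is never compact): consistency evidence for the node's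
closers and residue list, not an endorsement.  Proof-only (no `def`/instance/named fact; FACT-LIST
untouched).  Refereed prerequisite paper; no side taken on [IUTchIII] Cor 3.12; typed ≠ proved.
-/

noncomputable section

namespace Literature.AnabelianGeometry.AbsoluteAnabelian.AbsTopI.Prop410

open _root_.Topology _root_.Filter _root_.Set _root_.Function
open Literature.AnabelianGeometry.SemiGraphs
open Literature.AnabelianGeometry.AbsoluteAnabelian.AbsTopI
open Literature.IUT.HodgeTheaters (profiniteCompletion toCompletion toCompletion_int_injective)
open Literature.AlgebraicGeometry.Frobenioids (IsSlimGroup)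

variable {p : ℕ} [Fact p.Prime]

/-! ### `GroupLevelData` at compact slim models -/

/-- **Every COMPACT, totally disconnected, second countable §6 datum with slim `Π^tp` and slim
`Δ^tp` carries the L3 parameter bundle `GroupLevelData`** ([SemiAnbd] Ex. 3.10 pp. 43–45 as
parameters, ruling η′): Galois identification = the tree's `TemperedCurve.galoisIdentification`;
"tempered" because profinite ([SemiAnbd] Rmk 3.1.1); `Δ^tp = Ker(augK)` is closed, hence tempered.
[cite: MochizukiSemiAnbd2006, Ex 3.10 pp.43-45] -/
theorem nonempty_groupLevelData_of_compactSpace (Z : TemperedCurve p) [CompactSpace Z.PiTemp]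
    [TotallyDisconnectedSpace Z.PiTemp] [SecondCountableTopology Z.PiTemp]
    (hslim : IsSlimGroup Z.PiTemp) (hslimΔ : IsSlimGroup Z.DeltaTemp) :
    Nonempty Z.GroupLevelData := by
  haveI : T2Space Z.PiTemp := Z.t2Space_piTemp
  have hT : IsTempered Z.PiTemp := IsTempered.of_profinite
  have hker : (Z.augK Z.galoisIdentification).toMonoidHom.ker = Z.DeltaTemp :=
    Z.ker_augK Z.galoisIdentification
  have hTΔ : IsTempered (Z.augK Z.galoisIdentification).toMonoidHom.ker := by
    rw [hker]
    exact hT.subgroup_of_isClosed _ Z.isClosed_deltaTemp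
  have hSΔ : IsSlimGroup (Z.augK Z.galoisIdentification).toMonoidHom.ker := by
    rw [hker]
    exact hslimΔ
  exact ⟨{ galEquiv := Z.galoisIdentification
           isTempered := hT
           isTempered_ker := hTΔ
           isSlimGroup := hslim
           isSlimGroup_ker := hSΔ
           secondCountableTopology := inferInstance }⟩

/-! ### The compact model `G_{ℚ_p} × F̂₃ ↠ G_{ℚ_p} × F̂₂` -/

/-- **[AbsTopI] Prop 4.10 (iii) at the construction is INHABITED (compact model).**  There are
`X Y : TemperedCurve p` over `ℚ_p` with `Π^tp_X = G_{ℚ_p} × F̂₃` (one cusp, inertia `îa(Ẑ)`),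
`Π^tp_Y = G_{ℚ_p} × F̂₂`, a de-cuspidalization datum `E : X → Y` (`f = f̂ = id × π̂`, `π̂` killing the
first generator; kernel clause PROVED), parameter bundles `dX`, `dY` (both `Δ^tp` slim: free profinite
of ranks 3 and 2), `Π^tp_X` compact and `Δ^tp_X` topologically finitely generated — so that, by the
compact-case closers, BOTH clauses of node (iii) hold at `E`: the co-free completion of `Π^tp_X` with
respect to `Π̂_Y` IS `Π^tp_Y`.  Honest label: direct-product compact model, not `π₁` of a curve.
[cite: MochizukiAbsTopI2012, Prop 4.10 (iii) p.60] -/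
theorem Prop410iiiAt.exists_compactModel (p : ℕ) [Fact p.Prime] :
    ∃ (X Y : TemperedCurve p) (E : DeCuspidalization X Y),
      Prop410iiiAt E ∧ Prop410iiiDeltaAt E ∧
      X.K = ⊥ ∧ Y.K = ⊥ ∧ Nonempty X.GroupLevelData ∧ Nonempty Y.GroupLevelData ∧
      CompactSpace X.PiTemp ∧ IsTopologicallyFinitelyGenerated X.DeltaTemp ∧
      X.PiTemp = (GQp p × profiniteCompletion (FreeGroup (Fin 3))) ∧
      Y.PiTemp = (GQp p × profiniteCompletion (FreeGroup (Fin 2))) ∧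
      (∃ x : X.Pt, X.IsCusp x) ∧ IsEmpty Y.Pt := by
  classical
  haveI : IsGalois ℚ_[p] (AlgebraicClosure ℚ_[p]) := {}
  haveI : T2Space (GQp p) := krullTopology_t2
  let P3 : ProfiniteGrp.{0} := profiniteCompletion (FreeGroup (Fin 3))
  let P2 : ProfiniteGrp.{0} := profiniteCompletion (FreeGroup (Fin 2))
  let Zh : ProfiniteGrp.{0} := profiniteCompletion (Multiplicative ℤ)
  let η₃ : FreeGroup (Fin 3) →* P3 := toCompletion (FreeGroup (Fin 3))
  let η₂ : FreeGroup (Fin 2) →* P2 := toCompletion (FreeGroup (Fin 2))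
  let ι : Multiplicative ℤ →* Zh := toCompletion (Multiplicative ℤ)
  let a : FreeGroup (Fin 3) := FreeGroup.of 0
  let b : FreeGroup (Fin 3) := FreeGroup.of 1
  let c : FreeGroup (Fin 3) := FreeGroup.of 2
  -- the projection killing `a`, and its section
  let πg : Fin 3 → FreeGroup (Fin 2) := ![1, FreeGroup.of 0, FreeGroup.of 1]
  let π : FreeGroup (Fin 3) →* FreeGroup (Fin 2) := FreeGroup.lift πg
  let sg : Fin 2 → FreeGroup (Fin 3) := ![b, c]
  let s : FreeGroup (Fin 2) →* FreeGroup (Fin 3) := FreeGroup.lift sg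
  have hπa : π a = 1 := by simp [π, πg, a]
  have hπb : π b = FreeGroup.of 0 := by simp [π, πg, b]
  have hπc : π c = FreeGroup.of 1 := by simp [π, πg, c]
  have hs0 : s (FreeGroup.of 0) = b := by simp [s, sg]
  have hs1 : s (FreeGroup.of 1) = c := by simp [s, sg]
  have hπs : ∀ w : FreeGroup (Fin 2), π (s w) = w := by
    have h : π.comp s = MonoidHom.id _ := FreeGroup.ext_hom _ _ fun i => match i with
      | 0 => by rw [MonoidHom.comp_apply, hs0, hπb]; rfl
      | 1 => by rw [MonoidHom.comp_apply, hs1, hπc]; rfl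
    exact fun w => DFunLike.congr_fun h w
  let σa : FreeGroup (Fin 3) →* Multiplicative ℤ :=
    FreeGroup.lift fun j => if j = (0 : Fin 3) then Multiplicative.ofAdd (1 : ℤ) else 1
  have hσaa : σa a = Multiplicative.ofAdd 1 := by simp [σa, a]
  let e : P3 →ₜ* Zh := (ProfiniteGrp.ProfiniteCompletion.lift (GrpCat.ofHom (ι.comp σa))).hom
  let πh : P3 →ₜ* P2 := (ProfiniteGrp.ProfiniteCompletion.lift (GrpCat.ofHom (η₂.comp π))).hom
  let sh : P2 →ₜ* P3 := (ProfiniteGrp.ProfiniteCompletion.lift (GrpCat.ofHom (η₃.comp s))).hom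
  let îa : Zh →ₜ* P3 :=
    (ProfiniteGrp.ProfiniteCompletion.lift (GrpCat.ofHom (η₃.comp (zpowersHom _ a)))).hom
  have he : ∀ g, e (η₃ g) = ι (σa g) := fun g => lift_hom_toCompletion Zh (ι.comp σa) g
  have hπh : ∀ g, πh (η₃ g) = η₂ (π g) := fun g => lift_hom_toCompletion P2 (η₂.comp π) g
  have hsh : ∀ w, sh (η₂ w) = η₃ (s w) := fun w => lift_hom_toCompletion P3 (η₃.comp s) w
  have hîa : ∀ k : ℤ, îa (ι (Multiplicative.ofAdd k)) = η₃ (a ^ k) := fun k => by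
    rw [lift_hom_toCompletion P3 (η₃.comp (zpowersHom _ a))]
    simp [zpowersHom_apply]
  have heîa : ∀ t, e (îa t) = t := TemperedFibreProduct.apply_apply_eq_self_of a σa hσaa e îa he hîa
  have hd2 : DenseRange η₂ :=
    ProfiniteGrp.ProfiniteCompletion.denseRange (GrpCat.of (FreeGroup (Fin 2)))
  have hd3 : DenseRange η₃ :=
    ProfiniteGrp.ProfiniteCompletion.denseRange (GrpCat.of (FreeGroup (Fin 3)))
  have hdZ : DenseRange ι :=
    ProfiniteGrp.ProfiniteCompletion.denseRange (GrpCat.of (Multiplicative ℤ))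
  -- `π̂ ∘ ŝ = id`
  have hπhsh : ∀ z, πh (sh z) = z := by
    have h := hd2.equalizer (πh.continuous.comp sh.continuous) continuous_id (by
      funext w
      change πh (sh (η₂ w)) = η₂ w
      rw [hsh, hπh, hπs])
    exact fun z => congr_fun h z
  -- `π̂ ∘ îa = 1`
  have hπhîa : ∀ t, πh (îa t) = 1 := by
    have h := hdZ.equalizer (πh.continuous.comp îa.continuous) continuous_const (by
      funext k
      change πh (îa (ι k)) = (1 : P2)
      have hk : k = Multiplicative.ofAdd (Multiplicative.toAdd k) := rfl
      rw [hk, hîa, hπh, map_zpow, hπa, one_zpow, map_one])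
    exact fun t => congr_fun h t
  -- `X`: `Π := G_{ℚ_p} × F̂₃`, `I := îa(Ẑ)`, `D := G_{ℚ_p} × I`; `Y`: `G_{ℚ_p} × F̂₂`; `f := id × π̂`
  let I : Subgroup P3 := îa.toMonoidHom.range
  have hIclosed : IsClosed (I : Set P3) := by
    have : (I : Set P3) = Set.range îa := by ext x; simp [I]
    exact this ▸ (isCompact_range îa.continuous).isClosed
  let D : Subgroup (GQp p × P3) := (⊤ : Subgroup (GQp p)).prod I
  have hDmem : ∀ x : GQp p × P3, x ∈ D ↔ x.2 ∈ I := fun x => by simp [D, Subgroup.mem_prod]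
  have hDclosed : IsClosed (D : Set (GQp p × P3)) := by
    have : (D : Set (GQp p × P3)) = Prod.snd ⁻¹' (I : Set P3) := by ext x; exact hDmem x
    exact this ▸ hIclosed.preimage continuous_snd
  let fst3 : GQp p × P3 →ₜ* GQp p := ContinuousMonoidHom.fst _ _
  have hfstD : fst3 '' (D : Set (GQp p × P3)) = Set.univ :=
    Set.eq_univ_of_forall fun g => ⟨(g, 1), (hDmem _).2 I.one_mem, rfl⟩
  have hinertia : Nonempty (↥(D ⊓ fst3.toMonoidHom.ker) ≃ₜ* ZHat) := by
    refine ⟨{ toFun := fun x => e x.1.2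
              invFun := fun t => ⟨(1, îa t), (hDmem _).2 ⟨t, rfl⟩, (MonoidHom.mem_ker).2 rfl⟩
              left_inv := fun x => ?_
              right_inv := fun t => heîa t
              map_mul' := fun x y => by
                change e ((x : GQp p × P3) * y).2 = e (x : GQp p × P3).2 * e (y : GQp p × P3).2
                rw [Prod.snd_mul, map_mul]
              continuous_toFun := e.continuous.comp (continuous_snd.comp continuous_subtype_val)
              continuous_invFun := (continuous_const.prodMk îa.continuous).subtype_mk _ }⟩
    obtain ⟨⟨g, z⟩, hgz⟩ := x
    have hg : g = 1 := (MonoidHom.mem_ker).1 (Subgroup.mem_inf.1 hgz).2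
    obtain ⟨u, hu⟩ : z ∈ I := (hDmem _).1 (Subgroup.mem_inf.1 hgz).1
    apply Subtype.ext
    change ((1 : GQp p), îa (e z)) = (g, z)
    rw [hg, ← hu]
    exact Prod.ext rfl (congrArg îa (heîa u))
  let X : TemperedCurve p :=
    { K := ⊥
      finiteDimensional_K := inferInstance
      PiTemp := GQp p × P3
      aug := fst3
      range_aug := by
        rw [IntermediateField.fixingSubgroup_bot]
        exact MonoidHom.range_eq_top.mpr Prod.fst_surjective
      PiHat := GQp p × P3
      toHat := ContinuousMonoidHom.id _
      isProfiniteCompletion_toHat := isProfiniteCompletion_id _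
      toHat_injective := Function.injective_id
      augHat := fst3
      augHat_comp := fun _ => rfl
      Pt := Unit
      IsCusp := fun _ => True
      decomp := fun _ => D
      isClosed_decomp := fun _ => hDclosed
      isOpen_aug_decomp := fun _ => by
        change IsOpen (fst3 '' (D : Set (GQp p × P3)))
        rw [hfstD]; exact isOpen_univ
      inertia_eq_bot := fun _ h => (h trivial).elim
      inertia_equiv_zHat := fun _ _ => hinertia }
  let fst2 : GQp p × P2 →ₜ* GQp p := ContinuousMonoidHom.fst _ _
  let Y : TemperedCurve p :=
    { K := ⊥
      finiteDimensional_K := inferInstance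
      PiTemp := GQp p × P2
      aug := fst2
      range_aug := by
        rw [IntermediateField.fixingSubgroup_bot]
        exact MonoidHom.range_eq_top.mpr Prod.fst_surjective
      PiHat := GQp p × P2
      toHat := ContinuousMonoidHom.id _
      isProfiniteCompletion_toHat := isProfiniteCompletion_id _
      toHat_injective := Function.injective_id
      augHat := fst2
      augHat_comp := fun _ => rfl
      Pt := PEmpty
      IsCusp := fun x => x.elim
      decomp := fun x => x.elim
      isClosed_decomp := fun x => x.elim
      isOpen_aug_decomp := fun x => x.elim
      inertia_eq_bot := fun x => x.elim
      inertia_equiv_zHat := fun x => x.elim }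
  let f : GQp p × P3 →ₜ* GQp p × P2 := (ContinuousMonoidHom.id (GQp p)).prodMap πh
  have hf : ∀ y : GQp p × P3, f y = (y.1, πh y.2) := fun _ => rfl
  have hinertia_eq : (X.inertia ()).map X.toHat.toMonoidHom = D ⊓ fst3.toMonoidHom.ker := by
    ext y
    exact ⟨by rintro ⟨z, hz, rfl⟩; exact hz, fun hy => ⟨y, hy, rfl⟩⟩
  have hSmem : ∀ y : GQp p × P3, y ∈ D ⊓ fst3.toMonoidHom.ker ↔ y.2 ∈ I ∧ y.1 = 1 := fun y => by
    rw [Subgroup.mem_inf, hDmem, MonoidHom.mem_ker]; rfl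
  -- the normal closure of `a` in `F₃` is killed by `u ↦ s(π u)⁻¹ · u`
  let Ncl : Subgroup (FreeGroup (Fin 3)) := Subgroup.normalClosure ({a} : Set (FreeGroup (Fin 3)))
  have hsecN : ∀ u : FreeGroup (Fin 3), (s (π u))⁻¹ * u ∈ Ncl := by
    intro u
    have hqa : (QuotientGroup.mk' Ncl) a = 1 :=
      (QuotientGroup.eq_one_iff a).mpr (Subgroup.subset_normalClosure (Set.mem_singleton a))
    have hhom : QuotientGroup.mk' Ncl = (QuotientGroup.mk' Ncl).comp (s.comp π) := by
      refine FreeGroup.ext_hom _ _ fun i => ?_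
      match i with
      | 0 => change _ = (QuotientGroup.mk' Ncl) (s (π a)); rw [hπa, map_one, hqa, map_one]
      | 1 => change _ = (QuotientGroup.mk' Ncl) (s (π b)); rw [hπb, hs0]
      | 2 => change _ = (QuotientGroup.mk' Ncl) (s (π c)); rw [hπc, hs1]
    have hq : (QuotientGroup.mk' Ncl) u = (QuotientGroup.mk' Ncl) (s (π u)) := by
      conv_lhs => rw [hhom]
      rfl
    have h1 : (QuotientGroup.mk' Ncl) ((s (π u))⁻¹ * u) = 1 := by
      rw [map_mul, map_inv, ← hq, inv_mul_cancel]
    exact (QuotientGroup.eq_one_iff _).mp h1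
  -- the kernel clause
  have hker : f.toMonoidHom.ker =
      (Subgroup.normalClosure ((D ⊓ fst3.toMonoidHom.ker : Subgroup (GQp p × P3)) :
        Set (GQp p × P3))).topologicalClosure := by
    set S : Set (GQp p × P3) :=
      ((D ⊓ fst3.toMonoidHom.ker : Subgroup (GQp p × P3)) : Set (GQp p × P3)) with hS
    set N : Subgroup (GQp p × P3) := (Subgroup.normalClosure S).topologicalClosure with hN
    haveI hNn : N.Normal := Subgroup.is_normal_topologicalClosure _
    have hNclosed : IsClosed (N : Set (GQp p × P3)) := Subgroup.isClosed_topologicalClosure _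
    apply le_antisymm
    · -- `Ker f̂ ≤ N`: the retraction argument in the Hausdorff quotient `Π / N`
      haveI : IsClosed (N : Set (GQp p × P3)) := hNclosed
      -- `(1, η a) ∈ S ⊆ N`
      have haS : ((1 : GQp p), η₃ a) ∈ S := by
        rw [hS]
        refine (hSmem _).2 ⟨⟨ι (Multiplicative.ofAdd 1), ?_⟩, rfl⟩
        change îa (ι (Multiplicative.ofAdd 1)) = η₃ a
        rw [hîa, zpow_one]
      have haN : ((1 : GQp p), η₃ a) ∈ N :=
        Subgroup.le_topologicalClosure _ (Subgroup.subset_normalClosure haS)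
      -- `v ∈ ⟨⟨a⟩⟩ ⇒ (1, η v) ∈ N` (`N` is normal and contains `(1, η a)`)
      have hvN : ∀ v : FreeGroup (Fin 3), v ∈ Ncl → ((1 : GQp p), η₃ v) ∈ N := fun v hv =>
        (Subgroup.normalClosure_le_normal (N := N.comap ((MonoidHom.inr (GQp p) P3).comp η₃))
          (fun w hw => by rw [Set.mem_singleton_iff] at hw; subst hw; exact haN)) hv
      -- the projection `πN` and the retraction-composite `ρ` agree on the dense `G × η(F₃)`
      let πN : GQp p × P3 → (GQp p × P3) ⧸ N := QuotientGroup.mk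
      let ρ : GQp p × P3 → (GQp p × P3) ⧸ N := fun y => πN (y.1, sh (πh y.2))
      have hπN : Continuous πN := QuotientGroup.continuous_mk
      have hρ : Continuous ρ :=
        hπN.comp (continuous_fst.prodMk (sh.continuous.comp (πh.continuous.comp continuous_snd)))
      have hdense : DenseRange (Prod.map (id : GQp p → GQp p) η₃) := denseRange_id.prodMap hd3
      have hagree : ρ ∘ Prod.map id η₃ = πN ∘ Prod.map id η₃ := by
        funext gu
        obtain ⟨g, u⟩ := gu
        change πN (g, sh (πh (η₃ u))) = πN (g, η₃ u)
        rw [hπh, hsh]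
        refine QuotientGroup.eq.mpr ?_
        have hprod : ((g, η₃ (s (π u)))⁻¹ * (g, η₃ u) : GQp p × P3) =
            (1, η₃ ((s (π u))⁻¹ * u)) := by
          refine Prod.ext ?_ ?_
          · simp
          · simp [map_mul, map_inv]
        rw [hprod]
        exact hvN _ (hsecN u)
      have hρπ : ρ = πN := hdense.equalizer hρ hπN hagree
      intro y hy
      have hy1 : f y = 1 := (MonoidHom.mem_ker).1 hy
      rw [hf] at hy1
      have h1 : y.1 = 1 := congrArg Prod.fst hy1
      have h2 : πh y.2 = 1 := congrArg Prod.snd hy1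
      have hπy : πN y = 1 := by
        rw [← congrFun hρπ y]
        change πN (y.1, sh (πh y.2)) = 1
        rw [h1, h2, map_one]
        rfl
      exact (QuotientGroup.eq_one_iff y).mp hπy
    · -- `N ≤ Ker f̂`: `S ⊆ Ker f̂`, kernels are closed and normal
      refine Subgroup.topologicalClosure_minimal _ (Subgroup.normalClosure_le_normal ?_) ?_
      · intro y hy
        rw [hS] at hy
        obtain ⟨⟨t, ht⟩, hy1⟩ := (hSmem y).1 hy
        rw [SetLike.mem_coe, MonoidHom.mem_ker]
        change f y = 1
        rw [hf, hy1, ← ht]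
        change ((1 : GQp p), πh (îa t)) = 1
        rw [hπhîa]; rfl
      · have : ((f.toMonoidHom.ker : Subgroup (GQp p × P3)) : Set (GQp p × P3)) = f ⁻¹' {1} := by
          ext y; simp [MonoidHom.mem_ker]
        exact this ▸ isClosed_singleton.preimage f.continuous
  have E : DeCuspidalization X Y :=
    { f := f
      fHat := f
      toHat_comp := fun _ => rfl
      aug_comp := fun _ => rfl
      fHat_surjective := fun z => ⟨(z.1, sh z.2), Prod.ext rfl (hπhsh z.2)⟩
      x := ()
      isCusp := trivial
      rational := by
        change fst3 '' (D : Set (GQp p × P3)) = Set.range fst3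
        rw [hfstD]
        exact (Set.range_eq_univ.mpr Prod.fst_surjective).symm
      ker_fHat := by rw [hinertia_eq]; exact hker }
  have hslim3 : IsSlimGroup P3 :=
    Literature.GroupTheory.isSlimGroup_profiniteCompletion_freeGroup (n := 3) (by norm_num)
  have hslim2 : IsSlimGroup P2 :=
    Literature.GroupTheory.isSlimGroup_profiniteCompletion_freeGroup (n := 2) le_rfl
  have hslimG : IsSlimGroup (GQp p) :=
    IsSubpadicFor.isSlimGroup_absoluteGaloisGroup (AbsTopIII.IsSubpadicFor.padic p)
  have hslimX : IsSlimGroup (GQp p × P3) := isSlimGroup_prod_of_profinite hslimG hslim3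
  have hslimY : IsSlimGroup (GQp p × P2) := isSlimGroup_prod_of_profinite hslimG hslim2
  haveI hscG : SecondCountableTopology (GQp p) :=
    Literature.NumberTheory.LocalFields.secondCountableTopology_galQp p
  haveI hsc3 : SecondCountableTopology P3 := secondCountableTopology_profiniteCompletion_freeGroup (Fin 3)
  haveI hsc2 : SecondCountableTopology P2 := secondCountableTopology_profiniteCompletion_freeGroup (Fin 2)
  -- `Δ^tp = 1 × F̂ₙ ≃ₜ* F̂ₙ`
  have eΔ : ∀ (Q : Type) [Group Q] [TopologicalSpace Q] (H : Subgroup (GQp p × Q)),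
      (∀ x, x ∈ H ↔ x.1 = 1) → Nonempty (Q ≃ₜ* H) := fun Q _ _ H hH =>
    ⟨{ toFun := fun z => ⟨(1, z), (hH _).2 rfl⟩
       invFun := fun y => y.1.2
       left_inv := fun z => rfl
       right_inv := fun y => Subtype.ext (Prod.ext ((hH _).1 y.2).symm rfl)
       map_mul' := fun z w => Subtype.ext (Prod.ext (by simp) rfl)
       continuous_toFun := (continuous_const.prodMk continuous_id).subtype_mk _
       continuous_invFun := continuous_snd.comp continuous_subtype_val }⟩
  have hΔX : ∀ x : GQp p × P3, x ∈ X.DeltaTemp ↔ x.1 = 1 := fun x => MonoidHom.mem_ker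
  have hΔY : ∀ x : GQp p × P2, x ∈ Y.DeltaTemp ↔ x.1 = 1 := fun x => MonoidHom.mem_ker
  obtain ⟨eX⟩ := eΔ P3 X.DeltaTemp hΔX
  obtain ⟨eY⟩ := eΔ P2 Y.DeltaTemp hΔY
  have hslimΔX : IsSlimGroup X.DeltaTemp := isSlimGroup_of_continuousMulEquiv eX hslim3
  have hslimΔY : IsSlimGroup Y.DeltaTemp := isSlimGroup_of_continuousMulEquiv eY hslim2
  haveI : CompactSpace X.PiTemp := inferInstanceAs (CompactSpace (GQp p × P3))
  haveI : CompactSpace Y.PiTemp := inferInstanceAs (CompactSpace (GQp p × P2))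
  haveI : TotallyDisconnectedSpace X.PiTemp := inferInstanceAs (TotallyDisconnectedSpace (GQp p × P3))
  haveI : TotallyDisconnectedSpace Y.PiTemp := inferInstanceAs (TotallyDisconnectedSpace (GQp p × P2))
  haveI : SecondCountableTopology X.PiTemp := inferInstanceAs (SecondCountableTopology (GQp p × P3))
  haveI : SecondCountableTopology Y.PiTemp := inferInstanceAs (SecondCountableTopology (GQp p × P2))
  obtain ⟨dX⟩ := nonempty_groupLevelData_of_compactSpace X hslimX hslimΔX
  obtain ⟨dY⟩ := nonempty_groupLevelData_of_compactSpace Y hslimY hslimΔY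
  -- tfg of `Δ^tp_X ≅ F̂₃`
  have htfg3 : IsTopologicallyFinitelyGenerated P3 :=
    (SemiGraphOfAnabelioids.IsProSigmaCompletion.isProSigmaCompletion_toCompletion
      (FreeGroup (Fin 3))).isTopologicallyFinitelyGenerated_of_fg
  have htfg : IsTopologicallyFinitelyGenerated X.DeltaTemp :=
    htfg3.of_denseRange
      ({ toMonoidHom := eX.toMulEquiv.toMonoidHom, continuous_toFun := eX.continuous } :
        P3 →ₜ* X.DeltaTemp) eX.surjective.denseRange
  exact ⟨X, Y, E, E.prop410iiiAt_of_compactSpace htfg dX dY,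
    E.prop410iiiDeltaAt_of_compactSpace htfg dX dY, rfl, rfl, ⟨dX⟩, ⟨dY⟩, inferInstance, htfg,
    rfl, rfl, ⟨(), trivial⟩, inferInstanceAs (IsEmpty PEmpty)⟩

end Literature.AnabelianGeometry.AbsoluteAnabelian.AbsTopI.Prop410

end
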